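import Literature.Barriers.QuantumAdvantage.TensorNetworkContractionTreewidth
import HarnessLib

/-!
# Barrier catalogue `QuantumAdvantage` — the explicit rooted path decomposition of the circuit graph under a supplied wire ordering (Markov–Shi Prop 5.1)

Companion to `TensorNetworkContractionTreewidth.lean` (`treewidth_circuitGraph_le`: under a
linear ordering `σ` of the wires with cut parameter `r = cutParamUnder σ C`, the bags
`bagAt C σ i j` — Markov–Shi's `B_{i-1} ∪ B_i` plus the two nodes of the wire at position `i`
around the time boundary `j` — read position by position and, within a position, time by time,
form a path decomposition of the circuit graph `G_C` of width `≤ 2r + 1`; and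
`RootedTreeDecomposition`, the rooted normal form consumed by the contraction theorem
`markovShi2008_thm46`). The restated `markovShi2008_prop51` (2026-08-15) supplies the ordering
`σ_n` by a polynomial-time function; what separates it from `markovShi2008_thm46` is an `FP`
function `1ⁿ ↦ 𝒯_n` producing that path decomposition IN THE ROOTED NORMAL FORM. This file
builds the mathematical object — a path is a rooted tree with `parent p = p - 1`:

* `pathDecomp σ C hN : RootedTreeDecomposition (circuitGraph C) (N · (T + 1))` (`N > 0`
  wires, `T` gates): bag `p ↦ bagAt C σ ⟨p / (T+1)⟩ (p % (T+1))`, parent `p ↦ p - 1`; rooted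
  (T3) is the lexicographic-interval property of the grid bags (`mem_bagAt_of_between`,
  extracted from the proof of `treewidth_circuitGraph_le`);
* `width_pathDecomp_le : width ≤ 2 · cutParamUnder σ C + 1` (`card_bagAt_le`);
* `emptyDecomp` (no wires: one empty bag) and its width `0`;
* the codes: `encode_pathDecomp` / `encode_emptyDecomp` spell `RootedTreeDecomposition.encode`
  of these decompositions as explicit lists (parents `[0, 0, 1, …, k - 2]`, bags the sorted code
  lists `bagCodes`), the form a machine prints.

## References

* [MarkovShi2008] I. L. Markov, Y. Shi, SIAM J. Comput. 38 (2008) 963–981, §5 (proof of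
  Prop 5.1: the bags `B_i`), §4 (Thm 4.6: the decomposition handed to Steps 3–4).
* [AroraBarak2009] S. Arora, B. Barak, *Computational Complexity*, CUP 2009, §0.1 (codes of lists).
-/

noncomputable section

namespace Literature.Barriers.QuantumAdvantage

open Literature.Computability.Cryptography Literature.Combinatorics.SimpleGraph

variable {G : QGateSet} {N : ℕ}

/-! ### The lexicographic-interval property of the grid bags -/

/-- **The bags containing a node form a lexicographic interval of the grid**: if `u` lies in the
bags at `(i₁, j₁)` and `(i₂, j₂)` and `(i₁, j₁) ≤ (i, j) ≤ (i₂, j₂)` lexicographically, then `u`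
lies in the bag at `(i, j)` (single-wire nodes occur at one position on an interval of times,
multi-wire gates on an interval of positions at all times). [cite: MarkovShi2008, §5 (proof of Prop 5.1)] -/
theorem mem_bagAt_of_between {C : QCircuit G N} (σ : Fin N ≃ Fin N) {u : CircuitNode C.gates.length N}
    {i₁ i i₂ : Fin N} {j₁ j j₂ : ℕ}
    (hl₁ : (i₁ : ℕ) < i ∨ (i₁ = i ∧ j₁ ≤ j)) (hl₂ : (i : ℕ) < i₂ ∨ (i = i₂ ∧ j ≤ j₂))
    (hu₁ : u ∈ bagAt C σ i₁ j₁) (hu₂ : u ∈ bagAt C σ i₂ j₂) : u ∈ bagAt C σ i j := by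
  by_cases hs : SingleWire C u
  · rw [hs.mem_bagAt_iff] at hu₁ hu₂ ⊢
    have hw := hs (onWire_of_mem_around hu₁) (onWire_of_mem_around hu₂)
    have h12 : i₁ = i₂ := by simpa using congrArg σ hw
    subst h12
    have hii : i = i₁ := by
      rcases hl₁ with h | ⟨h, _⟩ <;> rcases hl₂ with h' | ⟨h', _⟩
      · exact absurd (h.trans h') (lt_irrefl _)
      · exact h'
      · exact h.symm
      · exact h'
    subst hii
    have hj₁ : j₁ ≤ j := by rcases hl₁ with h | ⟨_, h⟩; exact absurd h (lt_irrefl _); exact h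
    have hj₂ : j ≤ j₂ := by rcases hl₂ with h | ⟨_, h⟩; exact absurd h (lt_irrefl _); exact h
    exact mem_around_of_mem_of_mem hu₁ hu₂ hj₁ hj₂
  · cases u with
    | input w => exact absurd (singleWire_input C w) hs
    | output w => exact absurd (singleWire_output C w) hs
    | gate t =>
      have h2 := exists_lt_of_not_singleWire hs σ
      rw [gate_mem_bagAt_iff_spans h2] at hu₁ hu₂ ⊢
      refine hu₁.of_le_of_le hu₂ ?_ ?_
      · rcases hl₁ with h | ⟨h, _⟩; exact h.le; exact h.le
      · rcases hl₂ with h | ⟨h, _⟩; exact h.le; exact h.le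

/-! ### The rooted path decomposition -/

/-- The grid cell of a path index: position `p / (T + 1)`, time boundary `p % (T + 1)`. [folklore] -/
theorem div_lt_of_lt_mul {T p : ℕ} (hp : p < N * (T + 1)) : p / (T + 1) < N :=
  Nat.div_lt_of_lt_mul (by rwa [Nat.mul_comm] at hp)

/-- **The rooted path decomposition of the circuit graph under the wire ordering `σ`**
(`N > 0` wires, `T` gates; `N · (T + 1)` bags): the bag of index `p` is the grid bag at position
`p / (T+1)` and time boundary `p % (T+1)` (lexicographic order), the parent of `p` is `p - 1`.
[cite: MarkovShi2008, §5 (proof of Prop 5.1)] -/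
def pathDecomp (σ : Fin N ≃ Fin N) (C : QCircuit G N) (hN : 0 < N) (hC : ∀ g ∈ C.gates, g.wires.Nonempty) :
    RootedTreeDecomposition (circuitGraph C) (N * (C.gates.length + 1)) where
  pos := Nat.mul_pos hN (Nat.succ_pos _)
  parent p := ⟨(p : ℕ) - 1, lt_of_le_of_lt (Nat.sub_le _ _) p.isLt⟩
  parent_lt p hp := by simp only; omega
  bag p := bagAt C σ ⟨(p : ℕ) / (C.gates.length + 1), div_lt_of_lt_mul p.isLt⟩ ((p : ℕ) % (C.gates.length + 1))
  exists_mem_bag_of_adj := by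
    intro u v huv
    rw [circuitGraph_adj] at huv
    -- the segment lies in the bag at (its position, the stamp of its earlier end)
    have key : ∀ {a b : CircuitNode C.gates.length N} (w : Fin N), Consecutive C w a b →
        ∃ p : Fin (N * (C.gates.length + 1)), a ∈ bagAt C σ ⟨(p : ℕ) / (C.gates.length + 1), div_lt_of_lt_mul p.isLt⟩
          ((p : ℕ) % (C.gates.length + 1)) ∧ b ∈ bagAt C σ ⟨(p : ℕ) / (C.gates.length + 1), div_lt_of_lt_mul p.isLt⟩
          ((p : ℕ) % (C.gates.length + 1)) := by
      intro a b w hc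
      have hlt : a.pos < C.gates.length + 1 := lt_of_lt_of_le hc.2.2.1 b.pos_le
      have hp : ((σ w : Fin N) : ℕ) * (C.gates.length + 1) + a.pos < N * (C.gates.length + 1) := by
        have := (σ w).isLt
        calc ((σ w : Fin N) : ℕ) * (C.gates.length + 1) + a.pos
            < ((σ w : Fin N) : ℕ) * (C.gates.length + 1) + (C.gates.length + 1) := by omega
          _ = (((σ w : Fin N) : ℕ) + 1) * (C.gates.length + 1) := by ring
          _ ≤ N * (C.gates.length + 1) := Nat.mul_le_mul_right _ this
      refine ⟨⟨_, hp⟩, ?_⟩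
      have hdiv : (((σ w : Fin N) : ℕ) * (C.gates.length + 1) + a.pos) / (C.gates.length + 1) = ((σ w : Fin N) : ℕ) := by
        rw [Nat.mul_comm, Nat.mul_add_div (Nat.succ_pos _), Nat.div_eq_of_lt hlt, Nat.add_zero]
      have hmod : (((σ w : Fin N) : ℕ) * (C.gates.length + 1) + a.pos) % (C.gates.length + 1) = a.pos := by
        rw [Nat.mul_comm, Nat.mul_add_mod, Nat.mod_eq_of_lt hlt]
      have hi : (⟨(((σ w : Fin N) : ℕ) * (C.gates.length + 1) + a.pos) / (C.gates.length + 1),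
          div_lt_of_lt_mul hp⟩ : Fin N) = σ w := Fin.ext hdiv
      simp only [hmod]
      rw [hi, mem_bagAt, mem_bagAt, Equiv.symm_apply_apply]
      exact ⟨Or.inr (Or.inr hc.ends_mem_around.1), Or.inr (Or.inr hc.ends_mem_around.2)⟩
    rcases huv.2 with ⟨w, hc⟩ | ⟨w, hc⟩
    · exact key w hc
    · obtain ⟨p, h1, h2⟩ := key w hc
      exact ⟨p, h2, h1⟩
  exists_mem_bag := by
    intro u
    obtain ⟨w, hw⟩ := exists_onWire hC u
    obtain ⟨j, hj, hju⟩ := exists_mem_around hw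
    have hlt : j < C.gates.length + 1 := Nat.lt_succ_of_le hj
    have hp : ((σ w : Fin N) : ℕ) * (C.gates.length + 1) + j < N * (C.gates.length + 1) := by
      have := (σ w).isLt
      calc ((σ w : Fin N) : ℕ) * (C.gates.length + 1) + j
          < ((σ w : Fin N) : ℕ) * (C.gates.length + 1) + (C.gates.length + 1) := by omega
        _ = (((σ w : Fin N) : ℕ) + 1) * (C.gates.length + 1) := by ring
        _ ≤ N * (C.gates.length + 1) := Nat.mul_le_mul_right _ this
    refine ⟨⟨_, hp⟩, ?_⟩
    have hdiv : (((σ w : Fin N) : ℕ) * (C.gates.length + 1) + j) / (C.gates.length + 1) = ((σ w : Fin N) : ℕ) := by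
      rw [Nat.mul_comm, Nat.mul_add_div (Nat.succ_pos _), Nat.div_eq_of_lt hlt, Nat.add_zero]
    have hmod : (((σ w : Fin N) : ℕ) * (C.gates.length + 1) + j) % (C.gates.length + 1) = j := by
      rw [Nat.mul_comm, Nat.mul_add_mod, Nat.mod_eq_of_lt hlt]
    have hi : (⟨(((σ w : Fin N) : ℕ) * (C.gates.length + 1) + j) / (C.gates.length + 1), div_lt_of_lt_mul hp⟩ : Fin N) = σ w :=
      Fin.ext hdiv
    simp only [hmod]
    rw [hi, mem_bagAt, Equiv.symm_apply_apply]
    exact Or.inr (Or.inr hju)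
  mem_bag_parent := by
    intro v p hvp ⟨q, hvq, hqp⟩
    -- `q < p`, so `q ≤ p - 1 < p`: the interval property in the path order
    have hq1 : (q : ℕ) ≤ (p : ℕ) - 1 := by omega
    have lexle : ∀ {a b : ℕ}, a ≤ b → a / (C.gates.length + 1) < b / (C.gates.length + 1) ∨
        (a / (C.gates.length + 1) = b / (C.gates.length + 1) ∧ a % (C.gates.length + 1) ≤ b % (C.gates.length + 1)) := by
      intro a b hab
      rcases Nat.lt_or_ge (a / (C.gates.length + 1)) (b / (C.gates.length + 1)) with h | h
      · exact Or.inl h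
      · have heq : a / (C.gates.length + 1) = b / (C.gates.length + 1) := le_antisymm (Nat.div_le_div_right hab) h
        refine Or.inr ⟨heq, ?_⟩
        have ha := Nat.div_add_mod a (C.gates.length + 1)
        have hb := Nat.div_add_mod b (C.gates.length + 1)
        rw [heq] at ha
        omega
    have hlt1 : ((p : ℕ) - 1) / (C.gates.length + 1) < N := div_lt_of_lt_mul (lt_of_le_of_lt (Nat.sub_le _ _) p.isLt)
    exact mem_bagAt_of_between σ (i₁ := ⟨(q : ℕ) / (C.gates.length + 1), div_lt_of_lt_mul q.isLt⟩)
      (i := ⟨((p : ℕ) - 1) / (C.gates.length + 1), hlt1⟩) (i₂ := ⟨(p : ℕ) / (C.gates.length + 1), div_lt_of_lt_mul p.isLt⟩)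
      (by simpa [Fin.ext_iff] using lexle hq1) (by simpa [Fin.ext_iff] using lexle (Nat.sub_le (p : ℕ) 1)) hvq hvp

/-- **Width of the path decomposition**: `≤ 2 · cutParamUnder σ C + 1`. [cite: MarkovShi2008, §5 (proof of Prop 5.1)] -/
theorem width_pathDecomp_le (σ : Fin N ≃ Fin N) (C : QCircuit G N) (hN : 0 < N) (hC : ∀ g ∈ C.gates, g.wires.Nonempty) :
    (pathDecomp σ C hN hC).width ≤ 2 * C.cutParamUnder σ + 1 := by
  unfold RootedTreeDecomposition.width
  have : (Finset.univ.sup fun t => ((pathDecomp σ C hN hC).bag t).card) ≤ 2 * C.cutParamUnder σ + 2 :=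
    Finset.sup_le fun t _ => card_bagAt_le C σ _ _
  omega

/-- **The decomposition of a circuit without wires**: one empty bag (the circuit graph has no
vertices). [folklore] -/
def emptyDecomp (C : QCircuit G 0) (hC : ∀ g ∈ C.gates, g.wires.Nonempty) : RootedTreeDecomposition (circuitGraph C) 1 where
  pos := Nat.one_pos
  parent _ := 0
  parent_lt p hp := by have := p.isLt; omega
  bag _ := ∅
  exists_mem_bag_of_adj := by
    intro u v _
    obtain ⟨w, -⟩ := exists_onWire hC u
    exact w.elim0
  exists_mem_bag u := by
    obtain ⟨w, -⟩ := exists_onWire hC u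
    exact w.elim0
  mem_bag_parent v p hv := by simp at hv

/-- The decomposition without wires has width `0`. [folklore] -/
theorem width_emptyDecomp (C : QCircuit G 0) (hC : ∀ g ∈ C.gates, g.wires.Nonempty) : (emptyDecomp C hC).width = 0 := by
  unfold RootedTreeDecomposition.width
  simp [emptyDecomp]

end Literature.Barriers.QuantumAdvantage

end
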